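import Summits.QuantumFields.YangMills.Theorems.ScalingWindowSplitSelfNormalisedSkewnessStubParsevalGaussianSandwich
import Summits.QuantumFields.YangMills.Theorems.ScalingWindowSplitSelfNormalisedSkewnessStubParsevalGaussianMoments
import HarnessLib

/-!
# Crux `SelfNormalisedSkewness` (stmt-QuantumFields-18944, line `Sketch`): stub W3-3 —
# Gaussian comparison of the normalised small-box moments

Let `a : P → W` be a finite Parseval frame of a finite-dimensional real inner product space `W`
(`∑ p, ⟪a p, v⟫² = ‖v‖²`), `γ = stdGaussian W`, and let
`N ψ = ∫⁻_{B_ε} ψ · exp (-β ∑ p, (1 - cos ⟪a p, ·⟫)) d vol` be the weighted box integral over the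
small box `B_ε = {v | ∀ p, |⟪a p, v⟫| < ε}`.  For the quadratic forms `Q_A = ∑_{p ∈ A} ⟪a p, ·⟫²`
(`card A ≤ 6`) and their double and triple products `ψ_m` (`m = 1, 2, 3`) we show
`|N ψ_m / N 1 - β^{-m} E_γ ψ_m| ≤ C β^{-m} (β |P| ε⁴ + |P| t⁻⁶)`, `t = ε √β ≥ 1`, provided
`β |P| ε⁴ ≤ 1` and `γ {∃ p, t ≤ |⟪a p, ·⟫|} ≤ 1/2`.

Proof: the Parseval–Gaussian sandwich (`stub_parsevalGaussianSandwich`) squeezes `N ψ_m` between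
`I_g` and `e^{w₀} I_g`, `w₀ = β |P| ε⁴ / 24`, where by `m`-homogeneity
`I_g = (2π/β)^{d/2} β^{-m} ∫_{B_t} ψ_m dγ`; the moment and Markov-tail bounds of
`stub_parsevalGaussianMoments` control `∫_{B_t} ψ_m = E_γ ψ_m - ∫_{B_tᶜ} ψ_m` and
`γ(B_t) = 1 - γ(B_tᶜ) ∈ [1/2, 1]`; the rest is elementary ratio algebra over `ℝ`.
-/

noncomputable section

open scoped BigOperators ENNReal InnerProductSpace
open MeasureTheory ProbabilityTheory

namespace Summit.QuantumFields.YangMills.Theorems.SelfNormalisedSkewness.Negative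

section GaussianBoxComparisonHelpers

/-- Elementary ratio algebra behind the box/Gaussian comparison: if `n ∈ [z b J, e z b J]`,
`d ∈ [z J₁, e z J₁]` with `J = E - tl`, `J₁ = 1 - τ`, `0 ≤ tl, τ ≤ C₂ u`, `τ ≤ 1/2`, `E ≤ C₂` and
`e = exp w₀` with `w₀ ≤ 1/24`, then `|n/d - b E| ≤ b (2 C₂ w₀ + (6 C₂² + C₂) u)`. [folklore] -/
theorem ratio_abs_sub_le_of_sandwich {n d z b J J₁ E tl τ e w C₂ u : ℝ}
    (hz : 0 < z) (hb : 0 < b) (hw0 : 0 ≤ w) (hw : w ≤ 1 / 24) (he1 : 1 ≤ e)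
    (hew : e - 1 ≤ 2 * w) (hei : 1 - w ≤ e⁻¹) (hC₂ : 0 ≤ C₂) (hu : 0 ≤ u) (hE0 : 0 ≤ E)
    (hEC : E ≤ C₂) (htl0 : 0 ≤ tl) (htl : tl ≤ C₂ * u) (hJ : J = E - tl) (hJ0 : 0 ≤ J)
    (hτ0 : 0 ≤ τ) (hτ : τ ≤ 1 / 2) (hτu : τ ≤ C₂ * u) (hJ₁ : J₁ = 1 - τ)
    (hn1 : z * (b * J) ≤ n) (hn2 : n ≤ e * (z * (b * J))) (hd1 : z * J₁ ≤ d)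
    (hd2 : d ≤ e * (z * J₁)) :
    |n / d - b * E| ≤ b * (2 * C₂ * w + (6 * C₂ ^ 2 + C₂) * u) := by
  subst hJ hJ₁
  have hJ₁pos : (0 : ℝ) < 1 - τ := by linarith
  have hd : 0 < d := lt_of_lt_of_le (mul_pos hz hJ₁pos) hd1
  have he0 : 0 < e := by linarith
  have he3 : e ≤ 3 := by linarith
  have hJE : E - tl ≤ E := by linarith
  -- upper bound on the ratio
  have hup : n / d ≤ e * b * E * (1 + 2 * τ) := by
    have h1 : n / d ≤ (z * (e * b * E)) / (z * (1 - τ)) := by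
      refine div_le_div₀ (mul_nonneg hz.le (mul_nonneg (mul_nonneg he0.le hb.le) hE0)) ?_
        (mul_pos hz hJ₁pos) hd1
      calc n ≤ e * (z * (b * (E - tl))) := hn2
        _ ≤ e * (z * (b * E)) :=
          mul_le_mul_of_nonneg_left (mul_le_mul_of_nonneg_left
            (mul_le_mul_of_nonneg_left hJE hb.le) hz.le) he0.le
        _ = z * (e * b * E) := by ring
    rw [mul_div_mul_left _ _ hz.ne'] at h1
    refine h1.trans ?_
    rw [div_le_iff₀ hJ₁pos]
    have hkey : 1 ≤ (1 + 2 * τ) * (1 - τ) := by nlinarith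
    calc e * b * E = e * b * E * 1 := (mul_one _).symm
      _ ≤ e * b * E * ((1 + 2 * τ) * (1 - τ)) :=
        mul_le_mul_of_nonneg_left hkey (mul_nonneg (mul_nonneg he0.le hb.le) hE0)
      _ = e * b * E * (1 + 2 * τ) * (1 - τ) := by ring
  -- lower bound on the ratio
  have hlow : e⁻¹ * b * (E - tl) ≤ n / d := by
    rw [le_div_iff₀ hd]
    calc e⁻¹ * b * (E - tl) * d ≤ e⁻¹ * b * (E - tl) * (e * (z * (1 - τ))) :=
          mul_le_mul_of_nonneg_left hd2 (mul_nonneg (mul_nonneg (inv_nonneg.2 he0.le) hb.le) hJ0)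
      _ = z * (b * (E - tl)) * (1 - τ) := by field_simp
      _ ≤ z * (b * (E - tl)) * 1 :=
          mul_le_mul_of_nonneg_left (by linarith) (mul_nonneg hz.le (mul_nonneg hb.le hJ0))
      _ = z * (b * (E - tl)) := mul_one _
      _ ≤ n := hn1
  rw [abs_le]
  constructor
  · -- lower deviation
    have hinv1 : e⁻¹ ≤ 1 := inv_le_one_of_one_le₀ he1
    have h1 : E - e⁻¹ * (E - tl) ≤ C₂ * w + C₂ * u := by
      have ha : E * (1 - e⁻¹) ≤ E * w := mul_le_mul_of_nonneg_left (by linarith) hE0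
      have hb' : E * w ≤ C₂ * w := mul_le_mul_of_nonneg_right hEC hw0
      have hc : e⁻¹ * tl ≤ 1 * tl := mul_le_mul_of_nonneg_right hinv1 htl0
      linarith
    have h1' : b * (E - e⁻¹ * (E - tl)) ≤ b * (C₂ * w + C₂ * u) :=
      mul_le_mul_of_nonneg_left h1 hb.le
    have h2 : b * (C₂ * w + C₂ * u) ≤ b * (2 * C₂ * w + (6 * C₂ ^ 2 + C₂) * u) := by
      refine mul_le_mul_of_nonneg_left ?_ hb.le
      nlinarith [mul_nonneg hC₂ hw0, mul_nonneg (sq_nonneg C₂) hu]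
    linarith
  · -- upper deviation
    have h1 : E * (e * (1 + 2 * τ) - 1) ≤ C₂ * (2 * w + 6 * (C₂ * u)) := by
      refine mul_le_mul hEC ?_ ?_ hC₂
      · have h := mul_le_mul_of_nonneg_right he3 hτ0
        linarith
      · have h := mul_le_mul_of_nonneg_left (by linarith : (1 : ℝ) ≤ 1 + 2 * τ) he0.le
        linarith
    have h1' : b * (E * (e * (1 + 2 * τ) - 1)) ≤ b * (C₂ * (2 * w + 6 * (C₂ * u))) :=
      mul_le_mul_of_nonneg_left h1 hb.le
    have h3 : 0 ≤ b * (C₂ * u) := by positivity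
    linarith

variable {W : Type*} [NormedAddCommGroup W] [InnerProductSpace ℝ W]

/-- Quadratic frame forms are homogeneous of degree `β⁻¹` under `x ↦ x / √β`. [folklore] -/
theorem sum_inner_smul_sq {P : Type*} (a : P → W) (A : Finset P) {β : ℝ} (hβ : 0 ≤ β) (x : W) :
    ∑ p ∈ A, ⟪a p, (Real.sqrt β)⁻¹ • x⟫_ℝ ^ 2 = β⁻¹ * ∑ p ∈ A, ⟪a p, x⟫_ℝ ^ 2 := by
  rw [Finset.mul_sum]
  refine Finset.sum_congr rfl fun p _ => ?_
  rw [real_inner_smul_right, mul_pow, inv_pow, Real.sq_sqrt hβ]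

end GaussianBoxComparisonHelpers

section GaussianBoxComparisonSandwich

/-- Real form of the Parseval–Gaussian sandwich for a continuous nonnegative `ψ` that is homogeneous
of degree `β^{-m}` under `x ↦ x/√β`: with `z = (2π/β)^{dim W / 2}` and `J = ∫_{B_{ε√β}} ψ dγ`,
`z β^{-m} J ≤ N ψ ≤ exp (β |P| ε⁴ / 24) z β^{-m} J`. [folklore] -/
theorem toReal_box_sandwich {W : Type} [NormedAddCommGroup W] [InnerProductSpace ℝ W]
    [FiniteDimensional ℝ W] [MeasurableSpace W] [BorelSpace W] {P : Type} [Fintype P] (a : P → W)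
    (hframe : ∀ v : W, ∑ p, ⟪a p, v⟫_ℝ ^ 2 = ‖v‖ ^ 2) {β ε : ℝ} (hβ : 0 < β) (hε : 0 < ε)
    (N : (W → ℝ) → ℝ≥0∞)
    (hN : ∀ ψ : W → ℝ, N ψ = ∫⁻ v in {v : W | ∀ p, |⟪a p, v⟫_ℝ| < ε},
      ENNReal.ofReal (ψ v) * ENNReal.ofReal (Real.exp (-(β * ∑ p, (1 - Real.cos ⟪a p, v⟫_ℝ)))))
    {ψ : W → ℝ} (hψc : Continuous ψ) (hψ0 : ∀ x, 0 ≤ ψ x) {m : ℕ}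
    (hhom : ∀ x, ψ ((Real.sqrt β)⁻¹ • x) = β⁻¹ ^ m * ψ x)
    (hψi : Integrable ψ (stdGaussian W)) :
    (2 * Real.pi / β) ^ ((Module.finrank ℝ W : ℝ) / 2) * (β⁻¹ ^ m *
        ∫ x in {x : W | ∀ p, |⟪a p, x⟫_ℝ| < ε * Real.sqrt β}, ψ x ∂(stdGaussian W)) ≤
      (N ψ).toReal ∧
    (N ψ).toReal ≤ Real.exp (β * Fintype.card P * ε ^ 4 / 24) *
      ((2 * Real.pi / β) ^ ((Module.finrank ℝ W : ℝ) / 2) * (β⁻¹ ^ m *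
        ∫ x in {x : W | ∀ p, |⟪a p, x⟫_ℝ| < ε * Real.sqrt β}, ψ x ∂(stdGaussian W))) := by
  have hmeas : Measurable fun v => ENNReal.ofReal (ψ v) := hψc.measurable.ennreal_ofReal
  obtain ⟨hlow, hup, hscale⟩ := stub_parsevalGaussianSandwich a hframe hβ hε _ hmeas
  have hz0 : 0 ≤ (2 * Real.pi / β) ^ ((Module.finrank ℝ W : ℝ) / 2) :=
    Real.rpow_nonneg (div_nonneg (by positivity) hβ.le) _
  have hβm : 0 ≤ β⁻¹ ^ m := pow_nonneg (inv_nonneg.2 hβ.le) _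
  have hJ0 : 0 ≤ ∫ x in {x : W | ∀ p, |⟪a p, x⟫_ℝ| < ε * Real.sqrt β}, ψ x ∂(stdGaussian W) :=
    setIntegral_nonneg (measurableSet_frameBox a _) fun x _ => hψ0 x
  have hkey : (∫⁻ x in {x : W | ∀ p, |⟪a p, x⟫_ℝ| < ε * Real.sqrt β},
      ENNReal.ofReal (ψ ((Real.sqrt β)⁻¹ • x)) ∂(stdGaussian W)) =
      ENNReal.ofReal (β⁻¹ ^ m *
        ∫ x in {x : W | ∀ p, |⟪a p, x⟫_ℝ| < ε * Real.sqrt β}, ψ x ∂(stdGaussian W)) := by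
    simp_rw [hhom, ENNReal.ofReal_mul hβm]
    rw [lintegral_const_mul _ hmeas,
      ofReal_integral_eq_lintegral_ofReal hψi.integrableOn (ae_of_all _ hψ0)]
  have hIg : (∫⁻ v in {v : W | ∀ p, |⟪a p, v⟫_ℝ| < ε}, ENNReal.ofReal (ψ v) *
      ENNReal.ofReal (Real.exp (-(β * ‖v‖ ^ 2 / 2)))) =
      ENNReal.ofReal ((2 * Real.pi / β) ^ ((Module.finrank ℝ W : ℝ) / 2) * (β⁻¹ ^ m *
        ∫ x in {x : W | ∀ p, |⟪a p, x⟫_ℝ| < ε * Real.sqrt β}, ψ x ∂(stdGaussian W))) := by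
    rw [hscale, hkey, ← ENNReal.ofReal_mul hz0]
  have h1 : ENNReal.ofReal ((2 * Real.pi / β) ^ ((Module.finrank ℝ W : ℝ) / 2) * (β⁻¹ ^ m *
        ∫ x in {x : W | ∀ p, |⟪a p, x⟫_ℝ| < ε * Real.sqrt β}, ψ x ∂(stdGaussian W))) ≤ N ψ :=
    calc _ = _ := hIg.symm
      _ ≤ _ := hlow
      _ = N ψ := (hN ψ).symm
  have h2 : N ψ ≤ ENNReal.ofReal (Real.exp (β * Fintype.card P * ε ^ 4 / 24) *
      ((2 * Real.pi / β) ^ ((Module.finrank ℝ W : ℝ) / 2) * (β⁻¹ ^ m *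
        ∫ x in {x : W | ∀ p, |⟪a p, x⟫_ℝ| < ε * Real.sqrt β}, ψ x ∂(stdGaussian W)))) :=
    calc N ψ = _ := hN ψ
      _ ≤ _ := hup
      _ = _ := by rw [hIg, ← ENNReal.ofReal_mul (Real.exp_pos _).le]
  have hfin : N ψ ≠ ⊤ := ne_top_of_le_ne_top ENNReal.ofReal_ne_top h2
  exact ⟨(ENNReal.ofReal_le_iff_le_toReal hfin).1 h1, ENNReal.toReal_le_of_le_ofReal
    (mul_nonneg (Real.exp_pos _).le (mul_nonneg hz0 (mul_nonneg hβm hJ0))) h2⟩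

/-- Real form of the Parseval–Gaussian sandwich for the constant `1`:
`z γ(B_{ε√β}) ≤ N 1 ≤ exp (β |P| ε⁴ / 24) z γ(B_{ε√β})`. [folklore] -/
theorem toReal_box_sandwich_one {W : Type} [NormedAddCommGroup W] [InnerProductSpace ℝ W]
    [FiniteDimensional ℝ W] [MeasurableSpace W] [BorelSpace W] {P : Type} [Fintype P] (a : P → W)
    (hframe : ∀ v : W, ∑ p, ⟪a p, v⟫_ℝ ^ 2 = ‖v‖ ^ 2) {β ε : ℝ} (hβ : 0 < β) (hε : 0 < ε)
    (N : (W → ℝ) → ℝ≥0∞)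
    (hN : ∀ ψ : W → ℝ, N ψ = ∫⁻ v in {v : W | ∀ p, |⟪a p, v⟫_ℝ| < ε},
      ENNReal.ofReal (ψ v) * ENNReal.ofReal (Real.exp (-(β * ∑ p, (1 - Real.cos ⟪a p, v⟫_ℝ))))) :
    (2 * Real.pi / β) ^ ((Module.finrank ℝ W : ℝ) / 2) *
        (stdGaussian W).real {x : W | ∀ p, |⟪a p, x⟫_ℝ| < ε * Real.sqrt β} ≤
      (N fun _ => 1).toReal ∧
    (N fun _ => 1).toReal ≤ Real.exp (β * Fintype.card P * ε ^ 4 / 24) *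
      ((2 * Real.pi / β) ^ ((Module.finrank ℝ W : ℝ) / 2) *
        (stdGaussian W).real {x : W | ∀ p, |⟪a p, x⟫_ℝ| < ε * Real.sqrt β}) := by
  have h := toReal_box_sandwich a hframe hβ hε N hN continuous_const (fun _ => zero_le_one)
    (m := 0) (ψ := fun _ => (1 : ℝ)) (fun x => by simp) (integrable_const 1)
  simpa only [setIntegral_const, smul_eq_mul, mul_one, pow_zero, one_mul] using h

end GaussianBoxComparisonSandwich

section GaussianBoxComparisonRatio

/-- The generic comparison: for a continuous nonnegative `ψ`, homogeneous of degree `β^{-m}` under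
`x ↦ x/√β`, with `E_γ ψ ≤ C₂` and Gaussian tail `∫_{T_t} ψ ≤ C₂ |P| t⁻⁶` (`t = ε√β ≥ 1`), and with
`γ(T_t) ≤ 1/2`, `γ(T_t) ≤ C₂ |P| t⁻⁶`, `β |P| ε⁴ ≤ 1`, the normalised box moment satisfies
`|N ψ / N 1 - β^{-m} E_γ ψ| ≤ (6 C₂² + 2 C₂) β^{-m} (β |P| ε⁴ + |P| t⁻⁶)`. [folklore] -/
theorem box_ratio_bound {W : Type} [NormedAddCommGroup W] [InnerProductSpace ℝ W]
    [FiniteDimensional ℝ W] [MeasurableSpace W] [BorelSpace W] {P : Type} [Fintype P] (a : P → W)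
    (hframe : ∀ v : W, ∑ p, ⟪a p, v⟫_ℝ ^ 2 = ‖v‖ ^ 2) {β ε : ℝ} (hβ : 0 < β) (hε : 0 < ε)
    (ht : 1 ≤ ε * Real.sqrt β) (hw : β * Fintype.card P * ε ^ 4 ≤ 1)
    (hhalf : (stdGaussian W).real {x : W | ∃ p, ε * Real.sqrt β ≤ |⟪a p, x⟫_ℝ|} ≤ 1 / 2)
    (N : (W → ℝ) → ℝ≥0∞)
    (hN : ∀ ψ : W → ℝ, N ψ = ∫⁻ v in {v : W | ∀ p, |⟪a p, v⟫_ℝ| < ε},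
      ENNReal.ofReal (ψ v) * ENNReal.ofReal (Real.exp (-(β * ∑ p, (1 - Real.cos ⟪a p, v⟫_ℝ)))))
    {C₂ : ℝ} (hC₂ : 0 ≤ C₂)
    (hτC : (stdGaussian W).real {x : W | ∃ p, ε * Real.sqrt β ≤ |⟪a p, x⟫_ℝ|} ≤
      C₂ * Fintype.card P * (ε * Real.sqrt β)⁻¹ ^ 6)
    {ψ : W → ℝ} (hψc : Continuous ψ) (hψ0 : ∀ x, 0 ≤ ψ x) {m : ℕ}
    (hhom : ∀ x, ψ ((Real.sqrt β)⁻¹ • x) = β⁻¹ ^ m * ψ x)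
    (hψi : Integrable ψ (stdGaussian W)) (hEC : ∫ x, ψ x ∂(stdGaussian W) ≤ C₂)
    (htail : ∫ x in {x : W | ∃ p, ε * Real.sqrt β ≤ |⟪a p, x⟫_ℝ|}, ψ x ∂(stdGaussian W) ≤
      C₂ * Fintype.card P * (ε * Real.sqrt β)⁻¹ ^ 6) :
    |(N ψ).toReal / (N fun _ => 1).toReal - β⁻¹ ^ m * ∫ x, ψ x ∂(stdGaussian W)| ≤
      (6 * C₂ ^ 2 + 2 * C₂) * β⁻¹ ^ m *
        (β * Fintype.card P * ε ^ 4 + Fintype.card P * (ε * Real.sqrt β)⁻¹ ^ 6) := by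
  have _ := ht
  -- the box `B_t` is the complement of the tail event `T_t`
  have hTm : MeasurableSet {x : W | ∃ p, ε * Real.sqrt β ≤ |⟪a p, x⟫_ℝ|} := by
    rw [Set.setOf_exists]
    exact MeasurableSet.iUnion fun p =>
      (isClosed_le continuous_const ((continuous_const.inner continuous_id).abs)).measurableSet
  have hBt : {x : W | ∀ p, |⟪a p, x⟫_ℝ| < ε * Real.sqrt β} =
      {x : W | ∃ p, ε * Real.sqrt β ≤ |⟪a p, x⟫_ℝ|}ᶜ := by
    ext x
    simp only [Set.mem_setOf_eq, Set.mem_compl_iff, not_exists, not_le]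
  -- the sandwich bounds, in real form
  obtain ⟨hn1, hn2⟩ := toReal_box_sandwich a hframe hβ hε N hN hψc hψ0 hhom hψi
  obtain ⟨hd1, hd2⟩ := toReal_box_sandwich_one a hframe hβ hε N hN
  rw [hBt, setIntegral_compl hTm hψi] at hn1 hn2
  rw [hBt, probReal_compl_eq_one_sub hTm] at hd1 hd2
  -- elementary numerical facts
  have hz : 0 < (2 * Real.pi / β) ^ ((Module.finrank ℝ W : ℝ) / 2) :=
    Real.rpow_pos_of_pos (div_pos (by positivity) hβ) _
  have hb : 0 < β⁻¹ ^ m := pow_pos (inv_pos.2 hβ) m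
  have hw0 : 0 ≤ β * Fintype.card P * ε ^ 4 / 24 := by positivity
  have hw24 : β * Fintype.card P * ε ^ 4 / 24 ≤ 1 / 24 := by linarith
  have he1 : 1 ≤ Real.exp (β * Fintype.card P * ε ^ 4 / 24) := Real.one_le_exp hw0
  have hew : Real.exp (β * Fintype.card P * ε ^ 4 / 24) - 1 ≤
      2 * (β * Fintype.card P * ε ^ 4 / 24) := by
    have h := Real.abs_exp_sub_one_le (x := β * Fintype.card P * ε ^ 4 / 24)
      (by rw [abs_of_nonneg hw0]; linarith)
    rw [abs_of_nonneg hw0] at h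
    exact (le_abs_self _).trans h
  have hei : 1 - β * Fintype.card P * ε ^ 4 / 24 ≤
      (Real.exp (β * Fintype.card P * ε ^ 4 / 24))⁻¹ := by
    rw [← Real.exp_neg]
    linarith [Real.add_one_le_exp (-(β * Fintype.card P * ε ^ 4 / 24))]
  have hu0 : 0 ≤ (Fintype.card P : ℝ) * (ε * Real.sqrt β)⁻¹ ^ 6 := by positivity
  have hE0 : 0 ≤ ∫ x, ψ x ∂(stdGaussian W) := integral_nonneg hψ0
  have htl0 : 0 ≤ ∫ x in {x : W | ∃ p, ε * Real.sqrt β ≤ |⟪a p, x⟫_ℝ|}, ψ x ∂(stdGaussian W) :=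
    setIntegral_nonneg hTm fun x _ => hψ0 x
  have hJ0 : 0 ≤ ∫ x, ψ x ∂(stdGaussian W) -
      ∫ x in {x : W | ∃ p, ε * Real.sqrt β ≤ |⟪a p, x⟫_ℝ|}, ψ x ∂(stdGaussian W) :=
    sub_nonneg.2 (setIntegral_le_integral hψi (ae_of_all _ hψ0))
  have hτ0 : 0 ≤ (stdGaussian W).real {x : W | ∃ p, ε * Real.sqrt β ≤ |⟪a p, x⟫_ℝ|} :=
    measureReal_nonneg
  have key := ratio_abs_sub_le_of_sandwich hz hb hw0 hw24 he1 hew hei hC₂ hu0 hE0 hEC htl0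
    (htail.trans_eq (mul_assoc _ _ _)) rfl hJ0 hτ0 hhalf (hτC.trans_eq (mul_assoc _ _ _)) rfl
    hn1 hn2 hd1 hd2
  refine key.trans ?_
  have hv0 : 0 ≤ β * Fintype.card P * ε ^ 4 := by positivity
  have hin : 2 * C₂ * (β * Fintype.card P * ε ^ 4 / 24) +
      (6 * C₂ ^ 2 + C₂) * (Fintype.card P * (ε * Real.sqrt β)⁻¹ ^ 6) ≤
      (6 * C₂ ^ 2 + 2 * C₂) *
        (β * Fintype.card P * ε ^ 4 + Fintype.card P * (ε * Real.sqrt β)⁻¹ ^ 6) := by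
    nlinarith [mul_nonneg hC₂ hv0, mul_nonneg (sq_nonneg C₂) hv0, mul_nonneg hC₂ hu0]
  calc β⁻¹ ^ m * (2 * C₂ * (β * Fintype.card P * ε ^ 4 / 24) +
        (6 * C₂ ^ 2 + C₂) * (Fintype.card P * (ε * Real.sqrt β)⁻¹ ^ 6))
      ≤ β⁻¹ ^ m * ((6 * C₂ ^ 2 + 2 * C₂) *
        (β * Fintype.card P * ε ^ 4 + Fintype.card P * (ε * Real.sqrt β)⁻¹ ^ 6)) :=
        mul_le_mul_of_nonneg_left hin hb.le
    _ = _ := by ring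

end GaussianBoxComparisonRatio

/-- **Stub W3-3 — Gaussian comparison of the normalised small-box moments of Wick squares against
the standard Gaussian, for a Parseval frame** (line `Sketch` of crux `SelfNormalisedSkewness`,
registered signature verbatim).  With `N ψ` the cosine-weighted integral over the small frame box
`{∀ p, |⟪a p, v⟫| < ε}`, `t = ε√β ≥ 1`, `β |P| ε⁴ ≤ 1` and `γ {∃ p, t ≤ |⟪a p, ·⟫|} ≤ 1/2`, the
normalised box moments of `Q_A`, `Q_A Q_B`, `Q_A Q_B Q_D` (`card ≤ 6`) differ from `β^{-m}` times
the standard Gaussian moments by at most `C β^{-m} (β |P| ε⁴ + |P| t⁻⁶)`. [folklore] -/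
theorem stub_gaussianBoxComparison : ∃ C : ℝ, 0 < C ∧ ∀ {W : Type} [NormedAddCommGroup W]
    [InnerProductSpace ℝ W] [FiniteDimensional ℝ W] [MeasurableSpace W] [BorelSpace W] {P : Type}
    [Fintype P] (a : P → W), (∀ v : W, ∑ p, ⟪a p, v⟫_ℝ ^ 2 = ‖v‖ ^ 2) →
    ∀ (β ε : ℝ), 0 < β → 0 < ε → 1 ≤ ε * Real.sqrt β → β * Fintype.card P * ε ^ 4 ≤ 1 →
    (stdGaussian W).real {x : W | ∃ p, ε * Real.sqrt β ≤ |⟪a p, x⟫_ℝ|} ≤ 1 / 2 →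
    ∀ (N : (W → ℝ) → ℝ≥0∞),
    (∀ ψ : W → ℝ, N ψ = ∫⁻ v in {v : W | ∀ p, |⟪a p, v⟫_ℝ| < ε},
      ENNReal.ofReal (ψ v) * ENNReal.ofReal (Real.exp (-(β * ∑ p, (1 - Real.cos ⟪a p, v⟫_ℝ))))) →
    ∀ (A B D : Finset P), A.card ≤ 6 → B.card ≤ 6 → D.card ≤ 6 →
    |(N fun x => ∑ p ∈ A, ⟪a p, x⟫_ℝ ^ 2).toReal / (N fun _ => 1).toReal -
        β⁻¹ * ∫ x, (∑ p ∈ A, ⟪a p, x⟫_ℝ ^ 2) ∂(stdGaussian W)| ≤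
      C * β⁻¹ * (β * Fintype.card P * ε ^ 4 + Fintype.card P * (ε * Real.sqrt β)⁻¹ ^ 6) ∧
    |(N fun x => (∑ p ∈ A, ⟪a p, x⟫_ℝ ^ 2) * (∑ p ∈ B, ⟪a p, x⟫_ℝ ^ 2)).toReal / (N fun _ => 1).toReal -
        β⁻¹ ^ 2 * ∫ x, (∑ p ∈ A, ⟪a p, x⟫_ℝ ^ 2) * (∑ p ∈ B, ⟪a p, x⟫_ℝ ^ 2) ∂(stdGaussian W)| ≤
      C * β⁻¹ ^ 2 * (β * Fintype.card P * ε ^ 4 + Fintype.card P * (ε * Real.sqrt β)⁻¹ ^ 6) ∧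
    |(N fun x => (∑ p ∈ A, ⟪a p, x⟫_ℝ ^ 2) * (∑ p ∈ B, ⟪a p, x⟫_ℝ ^ 2) * (∑ p ∈ D, ⟪a p, x⟫_ℝ ^ 2)).toReal /
          (N fun _ => 1).toReal -
        β⁻¹ ^ 3 * ∫ x, (∑ p ∈ A, ⟪a p, x⟫_ℝ ^ 2) * (∑ p ∈ B, ⟪a p, x⟫_ℝ ^ 2) * (∑ p ∈ D, ⟪a p, x⟫_ℝ ^ 2)
          ∂(stdGaussian W)| ≤
      C * β⁻¹ ^ 3 * (β * Fintype.card P * ε ^ 4 + Fintype.card P * (ε * Real.sqrt β)⁻¹ ^ 6) := by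
  obtain ⟨C₂, hC₂, hmom⟩ := stub_parsevalGaussianMoments
  refine ⟨6 * max C₂ 6 ^ 2 + 2 * max C₂ 6, by positivity, ?_⟩
  intro W _ _ _ _ _ P _ a hframe β ε hβ hε ht hw hhalf N hN A B D hA hB hD
  have h23 : C₂ ≤ max C₂ 6 := le_max_left _ _
  have h63 : (6 : ℝ) ≤ max C₂ 6 := le_max_right _ _
  have hC₃0 : 0 ≤ max C₂ 6 := hC₂.le.trans h23
  obtain ⟨hI1, hI2, hI3, hE1, hE2, hE3, htails⟩ := hmom a hframe A B D hA hB hD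
  obtain ⟨hτ, hT1, hT2, hT3⟩ := htails (ε * Real.sqrt β) ht
  have hu0 : 0 ≤ (Fintype.card P : ℝ) * (ε * Real.sqrt β)⁻¹ ^ 6 := by positivity
  have hlift : ∀ {y : ℝ}, y ≤ C₂ * Fintype.card P * (ε * Real.sqrt β)⁻¹ ^ 6 →
      y ≤ max C₂ 6 * Fintype.card P * (ε * Real.sqrt β)⁻¹ ^ 6 := fun h =>
    h.trans (by rw [mul_assoc, mul_assoc]; exact mul_le_mul_of_nonneg_right h23 hu0)
  have hsq : ∀ (S : Finset P) (x : W), ∑ p ∈ S, ⟪a p, (Real.sqrt β)⁻¹ • x⟫_ℝ ^ 2 =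
      β⁻¹ * ∑ p ∈ S, ⟪a p, x⟫_ℝ ^ 2 := fun S x => sum_inner_smul_sq a S hβ.le x
  have hQ0 : ∀ (S : Finset P) (x : W), 0 ≤ ∑ p ∈ S, ⟪a p, x⟫_ℝ ^ 2 :=
    fun S x => Finset.sum_nonneg fun p _ => sq_nonneg _
  have hhom1 : ∀ x : W, ∑ p ∈ A, ⟪a p, (Real.sqrt β)⁻¹ • x⟫_ℝ ^ 2 =
      β⁻¹ ^ 1 * ∑ p ∈ A, ⟪a p, x⟫_ℝ ^ 2 := fun x => by rw [hsq, pow_one]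
  have hhom2 : ∀ x : W, (∑ p ∈ A, ⟪a p, (Real.sqrt β)⁻¹ • x⟫_ℝ ^ 2) *
      (∑ p ∈ B, ⟪a p, (Real.sqrt β)⁻¹ • x⟫_ℝ ^ 2) =
      β⁻¹ ^ 2 * ((∑ p ∈ A, ⟪a p, x⟫_ℝ ^ 2) * (∑ p ∈ B, ⟪a p, x⟫_ℝ ^ 2)) := fun x => by
    rw [hsq, hsq]; ring
  have hhom3 : ∀ x : W, (∑ p ∈ A, ⟪a p, (Real.sqrt β)⁻¹ • x⟫_ℝ ^ 2) *
      (∑ p ∈ B, ⟪a p, (Real.sqrt β)⁻¹ • x⟫_ℝ ^ 2) * (∑ p ∈ D, ⟪a p, (Real.sqrt β)⁻¹ • x⟫_ℝ ^ 2) =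
      β⁻¹ ^ 3 * ((∑ p ∈ A, ⟪a p, x⟫_ℝ ^ 2) * (∑ p ∈ B, ⟪a p, x⟫_ℝ ^ 2) *
        (∑ p ∈ D, ⟪a p, x⟫_ℝ ^ 2)) := fun x => by
    rw [hsq, hsq, hsq]; ring
  refine ⟨?_, ?_, ?_⟩
  · have h := box_ratio_bound a hframe hβ hε ht hw hhalf N hN hC₃0 (hlift hτ)
      (ψ := fun x => ∑ p ∈ A, ⟪a p, x⟫_ℝ ^ 2) (by fun_prop) (hQ0 A) (m := 1) hhom1 hI1
      (hE1.trans h63) (hlift hT1)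
    simpa only [pow_one] using h
  · exact box_ratio_bound a hframe hβ hε ht hw hhalf N hN hC₃0 (hlift hτ)
      (ψ := fun x => (∑ p ∈ A, ⟪a p, x⟫_ℝ ^ 2) * (∑ p ∈ B, ⟪a p, x⟫_ℝ ^ 2)) (by fun_prop)
      (fun x => mul_nonneg (hQ0 A x) (hQ0 B x)) (m := 2) hhom2 hI2 (hE2.trans h23) (hlift hT2)
  · exact box_ratio_bound a hframe hβ hε ht hw hhalf N hN hC₃0 (hlift hτ)
      (ψ := fun x => (∑ p ∈ A, ⟪a p, x⟫_ℝ ^ 2) * (∑ p ∈ B, ⟪a p, x⟫_ℝ ^ 2) *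
        (∑ p ∈ D, ⟪a p, x⟫_ℝ ^ 2)) (by fun_prop)
      (fun x => mul_nonneg (mul_nonneg (hQ0 A x) (hQ0 B x)) (hQ0 D x)) (m := 3) hhom3 hI3
      (hE3.trans h23) (hlift hT3)

end Summit.QuantumFields.YangMills.Theorems.SelfNormalisedSkewness.Negative

end
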